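import Literature.MathematicalPhysics.QuantumLattice.HubbardTorusFluxStiffnessResponse
import Literature.MathematicalPhysics.QuantumLattice.FockMapOpD4
import Literature.MathematicalPhysics.QuantumLattice.MagneticHubbardTorusTrivialField
import HarnessLib

/-!
# The isotropic f-sum ceiling on the flux stiffness of the square Hubbard torus:
# `ρ_s L² ≤ ¼ (U ⟨D⟩ − E₀)`

Topic `Literature/MathematicalPhysics/QuantumLattice` (family `hubbard`); companion of
`HubbardTorusFluxStiffnessResponse.lean` (`stiffness_mul_sq_le_sum_re_hop_of_isGroundStateInSector`:
a flux stiffness of the zero-flux `(N_L, 0)` sector is bounded by the `e₁`-kinetic weight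
`K^{(0)}(ψ) = Σ_{x,σ} Re⟨ψ, c†_{x+e₁,σ} c_{x,σ} ψ⟩` of EVERY sector ground state `ψ`).

Two elementary steps make the bound ORIENTATION-FREE and express it through the energy and the
double occupancy (the form in which a certified energy window and a certified double-occupancy
window give a number — Hazra–Verma–Randeria 2019 eq. (4): `D̃ ∝` kinetic energy; Paramekanti–Trivedi–
Randeria 1998 eq. (3)):
* the second-quantised transposition `Γ = fockMapOp (d4Orb (sr 3))`, `(a, b) ↦ (b, a)`, maps sector
  ground states to sector ground states and the `e₁`-kinetic weight to the `e₂`-kinetic weight: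
  `K^{(0)}(Γψ) = K^{(1)}(ψ)` (`sum_re_hop_zero_fockMapOp_transpose`), hence `ρ_s L² ≤ K^{(1)}(ψ)` too;
* the energy of the torus splits as `Re⟨φ, H φ⟩ = −2 (K^{(0)} + K^{(1)})(φ) + U Σ_y Re⟨φ, n_{y↑}n_{y↓} φ⟩`
  (`re_star_dotProduct_hubbardTorus_mulVec_eq`).
Adding: **`ρ_s L² ≤ ¼ (U Σ_y Re⟨ψ, n_{y↑} n_{y↓} ψ⟩ − E_L(0))`** for every flux stiffness `ρ_s > 0` of
the sector and every unit sector ground state `ψ` (`stiffness_mul_sq_le_quarter_docc_sub_energy`),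
`E_L(0) = fluxEnergy L U δ 0` the sector energy. Per site this is `ρ_s ≤ ¼ (U d − e)`: a certified
ceiling on `d` and a certified floor on `e` bound every flux stiffness, with no orientation average.
Everything here is PROVED; no named facts.

PRIOR FORMALISATION (same hook, Summits side, programme pub-hubbard `bounds.tex` Thm 3 / Thm 3♯,
2026-08-20): `Summits/HubbardSuperconductivity/HubbardLadder/Bounds/StiffnessFromEnergyBrackets.lean`
(`re_expect_hubbardTorus_eq_kin`, `StiffnessCeilingFromEnergyBrackets`) and its rotation toolbox
`KinWeightCeilingTPrimeSymmetry.lean`; thermodynamic-limit passage `StiffnessFromEnergyBracketsTL.lean` /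
`…Sharp.lean`. This file is the Literature-layer twin in the `U⟨D⟩ − E₀` (double-occupancy) form.

References: T. Hazra, N. Verma, M. Randeria, PRX 9 (2019) 031049, eqs. (2)–(4)
[HazraVermaRanderia2019]; A. Paramekanti, N. Trivedi, M. Randeria, PRB 57 (1998) 11639, eq. (3)
[ParamekantiTrivediRanderia1998]; D. J. Scalapino, Phys. Rep. 250 (1995) 329, §2 (the point group)
[Scalapino1995]; F. H. L. Essler et al., The One-Dimensional Hubbard Model (2005) §2.2
[EsslerEtAl2005].
-/

noncomputable section

namespace Literature.MathematicalPhysics.QuantumLattice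

open Matrix Finset Literature.MathematicalPhysics.QuantumFieldTheory
  Literature.Probability.LatticeModels HubbardWave0

open scoped ComplexConjugate ComplexOrder

variable {L : ℕ} [NeZero L]

/-! ### The energy as kinetic weights plus double occupancy -/

/-- **The torus energy, bond by bond** (`L ≥ 3`): `Re⟨φ, H_L(1,U) φ⟩ =
−2 Σ_x Σ_i Σ_σ Re⟨φ, c†_{x+e_i,σ} c_{x,σ} φ⟩ + U Σ_y Re⟨φ, n_{y↑} n_{y↓} φ⟩` (the reversed hop has the
conjugate expectation). [cite: HazraVermaRanderia2019, eq. (4)] -/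
theorem re_star_dotProduct_hubbardTorus_mulVec_eq (hL : 3 ≤ L) (U : ℝ)
    (φ : Fock (Orb (FermionTorus 2 L))) :
    (star φ ⬝ᵥ (hubbardTorus 2 L 1 U *ᵥ φ)).re =
      -2 * (∑ x : Site 2 L, ∑ i : Fin 2, ∑ σ : Fin 2,
          (star φ ⬝ᵥ ((creation (orb (FermionTorus.ofTorusSite (Site.shift x i)) σ) *
            annihilation (orb (FermionTorus.ofTorusSite x) σ)) *ᵥ φ)).re) +
        U * ∑ y : FermionTorus 2 L, (star φ ⬝ᵥ ((numberOp y 0 * numberOp y 1) *ᵥ φ)).re := by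
  rw [← magneticHubbardTorus_one_eq_hubbardTorus hL]
  unfold magneticHubbardTorus
  have hx : (star φ ⬝ᵥ ((∑ x : Site 2 L, ∑ i : Fin 2, ∑ σ : Fin 2,
      ((((1 : GaugeConfig 2 L Circle) (x, i) : Circle) : ℂ) •
          (creation (orb (FermionTorus.ofTorusSite (Site.shift x i)) σ) *
            annihilation (orb (FermionTorus.ofTorusSite x) σ)) +
        (starRingEnd ℂ) (((1 : GaugeConfig 2 L Circle) (x, i) : Circle) : ℂ) •
          (creation (orb (FermionTorus.ofTorusSite x) σ) *
            annihilation (orb (FermionTorus.ofTorusSite (Site.shift x i)) σ)))) *ᵥ φ)).re =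
      2 * ∑ x : Site 2 L, ∑ i : Fin 2, ∑ σ : Fin 2,
          (star φ ⬝ᵥ ((creation (orb (FermionTorus.ofTorusSite (Site.shift x i)) σ) *
            annihilation (orb (FermionTorus.ofTorusSite x) σ)) *ᵥ φ)).re := by
    simp only [Pi.one_apply, Circle.coe_one, map_one, one_smul, Matrix.sum_mulVec, dotProduct_sum,
      Complex.re_sum, add_mulVec, dotProduct_add, Complex.add_re, Finset.mul_sum]
    refine Finset.sum_congr rfl fun x _ => Finset.sum_congr rfl fun i _ =>
      Finset.sum_congr rfl fun σ _ => ?_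
    rw [star_dotProduct_creation_mul_annihilation_mulVec_swap
        (orb (FermionTorus.ofTorusSite (Site.shift x i)) σ) (orb (FermionTorus.ofTorusSite x) σ),
      Complex.conj_re, two_mul]
  rw [add_mulVec, dotProduct_add, Complex.add_re, smul_mulVec, dotProduct_smul, smul_eq_mul,
    neg_mul, Complex.neg_re, Complex.ofReal_one, one_mul, hx, smul_mulVec, dotProduct_smul,
    smul_eq_mul, Complex.re_ofReal_mul]
  simp only [Matrix.sum_mulVec, dotProduct_sum, Complex.re_sum]
  ring

/-! ### The transposition `(a, b) ↦ (b, a)` -/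

omit [NeZero L] in
/-- The element `s r³` of `D₄` acts on the torus as the transposition `(a, b) ↦ (b, a)`.
[cite: Scalapino1995, §2] -/
theorem d4Site_sr_three (x : TorusSite 2 L) :
    d4Site (DihedralGroup.sr 3 : DihedralGroup 4) x = ![x 1, x 0] := by
  have h3 : ((3 : ZMod 4)).val = 3 := rfl
  simp only [d4Site, h3, Function.iterate_succ, Function.iterate_zero, Function.comp_apply, id_eq,
    rotSite, reflSite]
  funext j
  fin_cases j <;> simp

/-- The transposition is an involution in `D₄`: `(s r³)⁻¹ = s r³`. [folklore] -/
private theorem sr_three_inv : (DihedralGroup.sr 3 : DihedralGroup 4)⁻¹ = DihedralGroup.sr 3 := by decide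

omit [NeZero L] in
/-- The transposition exchanges the two lattice directions: `τ(x + e₁) = τ(x) + e₂`. [folklore] -/
private theorem d4Site_sr_three_shift_zero (x : Site 2 L) :
    d4Site (DihedralGroup.sr 3 : DihedralGroup 4) (Site.shift x 0) =
      Site.shift (d4Site (DihedralGroup.sr 3 : DihedralGroup 4) x) 1 := by
  rw [d4Site_sr_three, d4Site_sr_three]
  funext j
  fin_cases j <;> simp [QuantumFieldTheory.Site.shift]

/-- `d4Orb γ` on an orbital `(x, σ)` given by a torus site: `(γ x, σ)`. [folklore] -/
private theorem d4Orb_orb_ofTorusSite (γ : DihedralGroup 4) (x : TorusSite 2 L) (σ : Fin 2) :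
    d4Orb γ (orb (FermionTorus.ofTorusSite x) σ) = orb (FermionTorus.ofTorusSite (d4Site γ x)) σ := by
  simp [d4Orb, orb]

/-- Conjugating a hopping term by the second-quantised point-group operator moves both orbitals:
`Γ(γ) (c†_p c_q) Γ(γ)ᴴ = c†_{γp} c_{γq}`. [cite: EsslerEtAl2005, §2.2.1 eq. (2.35)] -/
theorem fockMapOp_d4Orb_mul_hop_mul_conjTranspose (γ : DihedralGroup 4) (p q : Orb (FermionTorus 2 L)) :
    fockMapOp (d4Orb γ) * (creation p * annihilation q) * (fockMapOp (d4Orb γ))ᴴ =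
      creation (d4Orb γ p) * annihilation (d4Orb γ q) := by
  have hb := d4Orb_bijective (L := L) γ
  have hu : fockMapOp (d4Orb γ) * (fockMapOp (d4Orb γ : Orb (FermionTorus 2 L) → _))ᴴ = 1 := by
    have h := Matrix.mem_unitaryGroup_iff.1 (fockMapOp_d4Orb_mem_unitaryGroup (L := L) γ)
    rwa [star_eq_conjTranspose] at h
  rw [← Matrix.mul_assoc (fockMapOp (d4Orb γ)) (creation p) (annihilation q), fockMapOp_mul_creation,
    Matrix.mul_assoc (creation (d4Orb γ p)) (fockMapOp (d4Orb γ)) (annihilation q),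
    fockMapOp_mul_annihilation _ hb,
    ← Matrix.mul_assoc (creation (d4Orb γ p)) (annihilation (d4Orb γ q)) (fockMapOp (d4Orb γ)),
    Matrix.mul_assoc (creation (d4Orb γ p) * annihilation (d4Orb γ q)) (fockMapOp (d4Orb γ))
      ((fockMapOp (d4Orb γ))ᴴ), hu, Matrix.mul_one]

/-- Expectations in a transformed vector: `⟨Γψ, A Γψ⟩ = ⟨ψ, (Γᴴ A Γ) ψ⟩`. [folklore] -/
private theorem stiffIso_star_mulVec_dotProduct_conj {n : Type*} [Fintype n] (Γ A : Matrix n n ℂ)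
    (ψ : n → ℂ) :
    star (Γ *ᵥ ψ) ⬝ᵥ (A *ᵥ (Γ *ᵥ ψ)) = star ψ ⬝ᵥ ((Γᴴ * A * Γ) *ᵥ ψ) := by
  rw [star_mulVec, ← dotProduct_mulVec, Matrix.mul_assoc, ← mulVec_mulVec, ← mulVec_mulVec]

/-- **The transposition turns the `e₁`-kinetic weight into the `e₂`-kinetic weight**:
`K^{(0)}(Γψ) = K^{(1)}(ψ)` for `Γ = fockMapOp (d4Orb (s r³))`. [cite: Scalapino1995, §2] -/
theorem sum_re_hop_zero_fockMapOp_transpose (ψ : Fock (Orb (FermionTorus 2 L))) :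
    (∑ x : Site 2 L, ∑ σ : Fin 2,
        (star (fockMapOp (d4Orb (DihedralGroup.sr 3 : DihedralGroup 4)) *ᵥ ψ) ⬝ᵥ
          ((creation (orb (FermionTorus.ofTorusSite (Site.shift x 0)) σ) *
            annihilation (orb (FermionTorus.ofTorusSite x) σ)) *ᵥ
            (fockMapOp (d4Orb (DihedralGroup.sr 3 : DihedralGroup 4)) *ᵥ ψ))).re) =
      ∑ x : Site 2 L, ∑ σ : Fin 2,
        (star ψ ⬝ᵥ ((creation (orb (FermionTorus.ofTorusSite (Site.shift x 1)) σ) *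
          annihilation (orb (FermionTorus.ofTorusSite x) σ)) *ᵥ ψ)).re := by
  set τ : DihedralGroup 4 := DihedralGroup.sr 3 with hτ
  have hconj : ∀ (x : Site 2 L) (σ : Fin 2),
      (fockMapOp (d4Orb τ))ᴴ * (creation (orb (FermionTorus.ofTorusSite (Site.shift x 0)) σ) *
          annihilation (orb (FermionTorus.ofTorusSite x) σ)) * fockMapOp (d4Orb τ) =
        creation (orb (FermionTorus.ofTorusSite (Site.shift (d4Site τ x) 1)) σ) *
          annihilation (orb (FermionTorus.ofTorusSite (d4Site τ x)) σ) := by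
    intro x σ
    have hinv : (fockMapOp (d4Orb τ : Orb (FermionTorus 2 L) → _))ᴴ = fockMapOp (d4Orb τ) := by
      rw [conjTranspose_fockMapOp_d4Orb, hτ, sr_three_inv]
    have h := fockMapOp_d4Orb_mul_hop_mul_conjTranspose (L := L) τ
      (orb (FermionTorus.ofTorusSite (Site.shift x 0)) σ) (orb (FermionTorus.ofTorusSite x) σ)
    rw [hinv] at h ⊢
    rw [h, d4Orb_orb_ofTorusSite, d4Orb_orb_ofTorusSite, hτ, d4Site_sr_three_shift_zero]
  simp_rw [stiffIso_star_mulVec_dotProduct_conj, hconj]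
  exact Equiv.sum_comp (d4SiteEquiv τ) (fun y : Site 2 L => ∑ σ : Fin 2,
    (star ψ ⬝ᵥ ((creation (orb (FermionTorus.ofTorusSite (Site.shift y 1)) σ) *
      annihilation (orb (FermionTorus.ofTorusSite y) σ)) *ᵥ ψ)).re)

/-! ### The isotropic f-sum ceiling -/

/-- **A flux stiffness is bounded by the `e₂`-kinetic weight as well** (`L ≥ 3`): under the
stiffness hypothesis `ρ_s θ² ≤ E_L(θ) − E_L(0)` (`|θ| ≤ θ₀`), every zero-flux `(N_L, 0)`-sector
ground state `ψ` has `ρ_s L² ≤ K^{(1)}(ψ) = Σ_{x,σ} Re⟨ψ, c†_{x+e₂,σ} c_{x,σ} ψ⟩` — the f-sum floor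
applied to the transposed ground state `Γψ`. [cite: HazraVermaRanderia2019, eqs. (2)–(4)] -/
theorem stiffness_mul_sq_le_sum_re_hop_one_of_isGroundStateInSector (hL : 3 ≤ L) (U δ : ℝ)
    {ρs θ₀ : ℝ} (hρs : 0 < ρs) (hθ₀ : 0 < θ₀)
    (hstiff : ∀ θ : ℝ, |θ| ≤ θ₀ → ρs * θ ^ 2 ≤ fluxEnergy L U δ θ - fluxEnergy L U δ 0)
    {ψ : Fock (Orb (FermionTorus 2 L))}
    (hgs : IsGroundStateInSector (hubbardTorus 2 L 1 U) (2 * ⌊(1 - δ) * (L : ℝ) ^ 2 / 2⌋₊) 0 ψ)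
    (h1 : star ψ ⬝ᵥ ψ = 1) :
    ρs * (L : ℝ) ^ 2 ≤ ∑ x : Site 2 L, ∑ σ : Fin 2,
      (star ψ ⬝ᵥ ((creation (orb (FermionTorus.ofTorusSite (Site.shift x 1)) σ) *
        annihilation (orb (FermionTorus.ofTorusSite x) σ)) *ᵥ ψ)).re := by
  set Γ := fockMapOp (d4Orb (DihedralGroup.sr 3 : DihedralGroup 4) : Orb (FermionTorus 2 L) → _)
    with hΓ
  have hgs' : IsGroundStateInSector (hubbardTorus 2 L 1 U) (2 * ⌊(1 - δ) * (L : ℝ) ^ 2 / 2⌋₊) 0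
      (Γ *ᵥ ψ) := hgs.fockMapOp_d4Orb_mulVec _
  have hu : Γᴴ * Γ = 1 := by
    have h := Matrix.mem_unitaryGroup_iff'.1
      (fockMapOp_d4Orb_mem_unitaryGroup (L := L) (DihedralGroup.sr 3 : DihedralGroup 4))
    rwa [star_eq_conjTranspose, ← hΓ] at h
  have h1' : star (Γ *ᵥ ψ) ⬝ᵥ (Γ *ᵥ ψ) = 1 := by
    rw [star_mulVec, ← dotProduct_mulVec, mulVec_mulVec, hu, one_mulVec, h1]
  have h := stiffness_mul_sq_le_sum_re_hop_of_isGroundStateInSector hL U δ hρs hθ₀ hstiff hgs' h1'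
  rwa [hΓ, sum_re_hop_zero_fockMapOp_transpose] at h

/-- **The isotropic f-sum ceiling on the flux stiffness** (`L ≥ 3`): if
`ρ_s θ² ≤ E_L(θ) − E_L(0)` for `|θ| ≤ θ₀` with `ρ_s, θ₀ > 0`, then for every zero-flux
`(N_L, 0)`-sector ground state `ψ` (unit vector) of `hubbardTorus 2 L 1 U`,
`ρ_s L² ≤ ¼ (U Σ_y Re⟨ψ, n_{y↑} n_{y↓} ψ⟩ − E_L(0))`, i.e. per site `ρ_s ≤ ¼ (U d − e)`: a ceiling on
the double occupancy and a floor on the energy bound every flux stiffness — the kinetic-energy bound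
of Paramekanti–Trivedi–Randeria (1998) eq. (3) / Hazra–Verma–Randeria (2019) eqs. (2)–(4) written
through `⟨−T⟩ = U⟨D⟩ − E₀`, with the two lattice directions contributing equally by the transposition
symmetry. [cite: HazraVermaRanderia2019, eqs. (2)–(4)] -/
theorem stiffness_mul_sq_le_quarter_docc_sub_energy (hL : 3 ≤ L) (U δ : ℝ)
    {ρs θ₀ : ℝ} (hρs : 0 < ρs) (hθ₀ : 0 < θ₀)
    (hstiff : ∀ θ : ℝ, |θ| ≤ θ₀ → ρs * θ ^ 2 ≤ fluxEnergy L U δ θ - fluxEnergy L U δ 0)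
    {ψ : Fock (Orb (FermionTorus 2 L))}
    (hgs : IsGroundStateInSector (hubbardTorus 2 L 1 U) (2 * ⌊(1 - δ) * (L : ℝ) ^ 2 / 2⌋₊) 0 ψ)
    (h1 : star ψ ⬝ᵥ ψ = 1) :
    ρs * (L : ℝ) ^ 2 ≤
      (U * ∑ y : FermionTorus 2 L, (star ψ ⬝ᵥ ((numberOp y 0 * numberOp y 1) *ᵥ ψ)).re -
        fluxEnergy L U δ 0) / 4 := by
  have h0 := stiffness_mul_sq_le_sum_re_hop_of_isGroundStateInSector hL U δ hρs hθ₀ hstiff hgs h1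
  have h1' := stiffness_mul_sq_le_sum_re_hop_one_of_isGroundStateInSector hL U δ hρs hθ₀ hstiff hgs h1
  have hE := re_star_dotProduct_hubbardTorus_mulVec_eq hL U ψ
  rw [re_star_dotProduct_mulVec_eq_fluxEnergy_zero U δ hgs h1] at hE
  have hsplit : (∑ x : Site 2 L, ∑ i : Fin 2, ∑ σ : Fin 2,
      (star ψ ⬝ᵥ ((creation (orb (FermionTorus.ofTorusSite (Site.shift x i)) σ) *
        annihilation (orb (FermionTorus.ofTorusSite x) σ)) *ᵥ ψ)).re) =
      (∑ x : Site 2 L, ∑ σ : Fin 2,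
        (star ψ ⬝ᵥ ((creation (orb (FermionTorus.ofTorusSite (Site.shift x 0)) σ) *
          annihilation (orb (FermionTorus.ofTorusSite x) σ)) *ᵥ ψ)).re) +
      ∑ x : Site 2 L, ∑ σ : Fin 2,
        (star ψ ⬝ᵥ ((creation (orb (FermionTorus.ofTorusSite (Site.shift x 1)) σ) *
          annihilation (orb (FermionTorus.ofTorusSite x) σ)) *ᵥ ψ)).re := by
    rw [← Finset.sum_add_distrib]
    refine Finset.sum_congr rfl fun x _ => ?_
    rw [Fin.sum_univ_two]
  rw [hsplit] at hE
  linarith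

end Literature.MathematicalPhysics.QuantumLattice
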